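import Summits.BirchSwinnertonDyer.BirchSwinnertonDyer.Theorems.GoldfeldAllTwistsTwoConverseTwinQuarterTraceSignaturesEFAlpha
import Summits.BirchSwinnertonDyer.BirchSwinnertonDyer.Theorems.GoldfeldAllTwistsTwoConverseTwinQuarterTracePartnerEAlpha
import Summits.BirchSwinnertonDyer.BirchSwinnertonDyer.Theorems.GoldfeldAllTwistsTwoConverseTwinQuarterTraceGenusTransport
import Summits.BirchSwinnertonDyer.BirchSwinnertonDyer.Theorems.GoldfeldAllTwistsTwoConverseTwinQuarterTraceSignaturesEAlpha
import Summits.BirchSwinnertonDyer.BirchSwinnertonDyer.Theorems.GoldfeldAllTwistsTwoConverseTwinQuarterTraceSignaturesEFAlphaPlusModFourAlpha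
import Summits.BirchSwinnertonDyer.BirchSwinnertonDyer.Theorems.GoldfeldAllTwistsTwoConverseTwinQuarterTraceSignaturesEAlphaModFourAlpha
import Summits.BirchSwinnertonDyer.BirchSwinnertonDyer.Theorems.GoldfeldAllTwistsTwoConverseTwinQuarterTracePartnerEAlphaModFourAlpha
import Summits.BirchSwinnertonDyer.BirchSwinnertonDyer.Theorems.GoldfeldAllTwistsTwoConverseTwinQuarterTracePartnerEAlphaHeightModFourAlpha
import Summits.BirchSwinnertonDyer.BirchSwinnertonDyer.Theorems.GoldfeldAllTwistsTwoConverseTwinQuarterTracePartnerPHeightModFour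
import HarnessLib

set_option linter.dupNamespace false -- namespace `…BirchSwinnertonDyer.BirchSwinnertonDyer…` is the cell's (D-0017 nested layout)
set_option autoImplicit false

/-!
# ORDER (ccclxxxii) tranche T2 = E⁺-3: `…QuarterTraceSignaturesEAlphaPlusModFourAlpha` — the type-α χ_e package over `K[1]` with its **`σ̃_q`-signature** at `(p/q) = +1`

Cell `bsd-goldfeld`, seat `bsd-goldfeld-s1p-c3x` (gen 15). OBJECT A7⁺ = cells a71+ ∪ a75+ (type α, `q ≡ 7 (mod 8)`, `(q/7) = −1`; `p ≡ 1 (mod 4)`,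
`(−7/p) = +1`, `−7 ∉ 𝔽_p^{×4}`; **`(p/q) = +1`**). PLUS TWIN of C7A-P's `exists_chiE_package_alpha_L_modFourAlpha` (`…QuarterTraceSignaturesEAlphaModFourAlpha` §2;
its §1 `exists_chiEAlpha_dataK_modFourAlpha` — the K-side half-trace relation under `h2`, parity-free — is IMPORTED, not restated).
STATEMENT DELTA (exactly): binder `h4e : ∀ Δ, Δ.D = −qp → ¬ 4 ∣ #Cl(𝒪_Δ)` ↦ **`hpq : jacobiSym p q = 1`**; binder `hBodd` DROPPED (idle here);
the signature clause `∀ σ̃, σ̃r_q = r_q → σ̃r_p = −r_p → ∃ k odd, k•(σ̃R_e + R_e) = T` ↦ **`∀ σ̃, σ̃r_q = −r_q → σ̃r_p = r_p → ∃ k odd, k•(σ̃R_e + R_e) = T`**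
(the genus lift `σ̃_q` of `K = ℚ(√−2qp)` replaces `σ̃_p`). MECHANISM (kill-switch K-E of the seat's memo PLUS-CHIZ-CHANNEL.md §3, settled in the kernel
by this file): with `R_e = (m₁M′)Φ − (m₁w)Y′` and `ψ = σ̃_qτ` fixing `F = ℚ(r_qr_p)`, `r_q` and `r_p`, the genus transport of `ψ` is a
PRINCIPAL-genus element of `Gal(F[1]/F)` (realised as `g̃²`), which fixes `Φ` and `Y′`; hence `σ̃_qR_e + R_e = (m₁M′κ′ − m₁w)•T` with
`κ′ = #Cl(F)²` EVEN at `(p/q) = +1` (E⁺-2) and `m₁, M′, w` odd — an ODD multiple of `T`, i.e. `= T`. (At `(p/q) = −1` the same element has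
signature `O` and `σ̃_p` carries `T`: the source.)
`--supports stmt-BirchSwinnertonDyer-20044 --as helper`. Theses-free; theorems only; no definition, no new fact, no `sorry`. Binders BY NAME as in
the source. FRONTIER-grade: twist-density-ZERO sub-family modulo named print; never distance-to-summit. HONEST FRAMING: items 19140 / 20044 unchanged;
BSD is not proved by any of this.
-/



noncomputable section

open scoped Classical IntermediateField

open WeierstrassCurve Literature.NumberTheory.EllipticCurves Literature.NumberTheory.EllipticCurves.ModularForms
  Literature.NumberTheory.EllipticCurves.CaiShuTian2014 Literature.NumberTheory.EllipticCurves.CoatesLiTianZhai2015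
  Literature.Computability.Cryptography.Hallgren2005

namespace Summit.BirchSwinnertonDyer.BirchSwinnertonDyer.Theorems.GoldfeldGoodTwists

-- the cell's point-group world over `K[1]` / `F[1]` / `ℂ` (F3e's); file-local
attribute [local instance 2000] Classical.propDecidable

section ChiE
variable {K : Type} [Field K] [NumberField K] (ι : K →+* ℂ) [FiniteDimensional K (ringClassField K ι 1)]
  [IsGalois K (ringClassField K ι 1)] [NumberField (ringClassField K ι 1)]

/-! ## The type-α χ_e package over `K[1]` with the `σ̃_q`-signature at `(p/q) = +1` -/

set_option maxHeartbeats 500000 in -- one long assembly (§1's data + X3α-3b pulled back to `K[1]` + the genus transport X3b-1), as X3b-2b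
/-- **The type-α `χ_e` package in `X₀(49)(K[1])` with its `σ̃_q`-signature at `(p/q) = +1`, under `r_an(49a1^{(−qp)}) = 1`.** Setting and binders of
C7A-P's `exists_chiE_package_alpha_L_modFourAlpha` with `h4e ↦ hpq : (p/q) = 1` and without `hBodd`; `B` with the genus properties `hBfix`, `hBS` and the range
property `hBL`. CONCLUSION: ODD `M_e`, points `R_e, t_e ∈ X₀(49)(K[1])` (`e_L R_e, e_L t_e ∈ B`, `t_e` torsion) with `M_e • P_e = 4 • R_e + t_e`, and for
every `σ̃ ∈ Gal(K[1]/K)` with `σ̃r_q = −r_q`, `σ̃r_p = r_p` an ODD `k` with `k • (σ̃R_e + R_e) = T`.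
[cite: Gross1984, §§4–5] [cite: GrossLMS1991, Prop. 5.3] [cite: CoatesLiTianZhai2015, Thm. 1.3, 1.4, 4.4 and (2.8)] [cite: Cox2013, §6.A Thm. 6.1] -/
theorem exists_chiE_package_alpha_L_plusModFourAlpha (hEta₀ : x049_x_sub_two_eq_etaQuotient) (hD : deuring_etaQuotient49_heegner_generates_conjPrime)
    (hEta : x049_heegner_norm_x_sub_two_not_mem) (h14 : thm14_rankOne_twist) (hCST : thm11_ringClassChar)
    (hGZ : ∀ (N : ℕ) [NeZero N] (W : WeierstrassCurve ℚ) (K : Type) [Field K] [NumberField K], gross_zagier N W K)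
    (h12 : thm12_fullBSD_twist) (h44 : thm44_ord_two_LAlg) (hS31 : bsdTriple_of_rank_le_one_of_conductor_lt) (hnew : exists_isNewformOf)
    (hBT : burungaleTian_analyticRank_eq_zero_of_selmerCorank_eq_zero_of_hasCM) (hBF : bsdTriple_of_hasCM_of_L_one_ne_zero)
    (hGZK : rank_eq_analyticRank_of_analyticRank_le_one)
    (hK : IsImaginaryQuadratic K) {q p : ℕ} (hq : q.Prime) (h3 : 3 < q) (hq4 : q % 4 = 3) (hq7 : jacobiSym q 7 = -1)
    [Fact p.Prime] (hp4 : p % 4 = 1) (hp7 : legendreSym p (-7) = 1) (hα : ¬ ∃ x : ZMod p, x ^ 4 = -7)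
    (hpq : jacobiSym (p : ℤ) q = 1)
    (hdK : NumberField.discr K = -(8 * (q : ℤ) * p))
    (h2 : (haveI := cm7.isElliptic_quadraticTwist (show (-((q : ℚ) * p)) ≠ 0 from neg_ne_zero.mpr (mul_ne_zero
        (by exact_mod_cast hq.ne_zero) (by exact_mod_cast (Fact.out : p.Prime).ne_zero)));
      (cm7.quadraticTwist (-((q : ℚ) * p))).analyticRank) = 1)
    (D₀ : ModularParametrizationData cm7 49) (hc : |D₀.c| = 1) (hw : cm7.rootNumber = 1)
    (h0 : ∃ h, D₀.cuspZeroPoint = Affine.Point.some 2 (-1) h)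
    {β : ℤ} (d : KolyvaginHeegnerData D₀ β ι 1) {rq rp : ringClassField K ι 1}
    (hrq : (rq : ℂ) ^ 2 = -(q : ℂ)) (hrp : (rp : ℂ) ^ 2 = (p : ℂ))
    (B : AddSubgroup (cm7.baseChange ℂ).toAffine.Point) (S : Subfield ℂ)
    (hBfix : ∀ P : (cm7.baseChange (ringClassField K ι 1)).toAffine.Point,
      (∀ σ : ringClassField K ι 1 ≃ₐ[K] ringClassField K ι 1, σ rq = rq → σ rp = rp →
        Affine.Point.map (σ : ringClassField K ι 1 →ₐ[K] ringClassField K ι 1) P = P) →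
      Affine.Point.map (W' := cm7) (ringClassField K ι 1).subtype.toRatAlgHom P ∈ B)
    (hBS : ∀ (E : Type) [Field E] [CharZero E] (e : E →+* ℂ), e.fieldRange ≤ S →
      ∀ z : (cm7.baseChange E).toAffine.Point, Affine.Point.map (W' := cm7) e.toRatAlgHom z ∈ B)
    (hSq : (rq : ℂ) ∈ S) (hSp : (rp : ℂ) ∈ S)
    (hBL : ∀ z ∈ B, ∃ P : (cm7.baseChange (ringClassField K ι 1)).toAffine.Point,
      Affine.Point.map (W' := cm7) (ringClassField K ι 1).subtype.toRatAlgHom P = z) :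
    ∃ (Me : ℤ) (Re te : (cm7.baseChange (ringClassField K ι 1)).toAffine.Point), Odd Me ∧ IsOfFinAddOrder te ∧
      Affine.Point.map (W' := cm7) (ringClassField K ι 1).subtype.toRatAlgHom Re ∈ B ∧
      Affine.Point.map (W' := cm7) (ringClassField K ι 1).subtype.toRatAlgHom te ∈ B ∧
      Me • (∑ σ : ringClassField K ι 1 ≃ₐ[K] ringClassField K ι 1,
          ((if σ rq = rq then (1 : ℤ) else -1) * (if σ rp = rp then (1 : ℤ) else -1)) •
            Affine.Point.map (σ : ringClassField K ι 1 →ₐ[K] ringClassField K ι 1) d.y) = (4 : ℤ) • Re + te ∧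
      ∀ σ : ringClassField K ι 1 ≃ₐ[K] ringClassField K ι 1, σ rq = -rq → σ rp = rp →
        ∃ k : ℤ, Odd k ∧ k • (Affine.Point.map (σ : ringClassField K ι 1 →ₐ[K] ringClassField K ι 1) Re + Re) =
          Affine.Point.some 2 (-1) (nonsingular_cm7_baseChange_two_neg_one (ringClassField K ι 1)) := by
  haveI : (cm7.baseChange (ringClassField K ι 1)).IsElliptic := by rw [WeierstrassCurve.baseChange]; infer_instance
  have hp : p.Prime := Fact.out
  obtain ⟨hp2, hp7', hp4⟩ := prime_ne_two_ne_seven_of_mod_four_one hp4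
  obtain ⟨hq2, hqp, hqodd, hpeven, hqp4⟩ := arith_negEightTwoPrimes_modFour hq4 hp4
  have hrK := sq_eq_algebraMap_neg_natCast (ι := ι) hrq
  have hrpK := sq_eq_algebraMap_natCast' (ι := ι) hrp
  have hq0 : (q : ringClassField K ι 1) ≠ 0 := by exact_mod_cast hq.ne_zero
  have hpL : (p : ringClassField K ι 1) ≠ 0 := by exact_mod_cast hp.ne_zero
  have hrq0 : rq ≠ 0 := by
    intro h; rw [h, zero_pow two_ne_zero, map_neg, map_natCast] at hrK
    exact hq0 (neg_eq_zero.mp hrK.symm)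
  have hrp0 : rp ≠ 0 := by
    intro h; rw [h, zero_pow two_ne_zero, map_natCast] at hrpK
    exact hpL hrpK.symm
  have hre : ((rq * rp : ringClassField K ι 1) : ℂ) ^ 2 = -((q : ℂ) * p) := by
    push_cast; rw [mul_pow, hrq, hrp]; ring
  have hreK : (rq * rp) ^ 2 = algebraMap K (ringClassField K ι 1) (-((q : K) * p)) := by
    rw [mul_pow, hrK, hrpK, ← map_mul]; congr 1; ring
  obtain ⟨τ, H₂, P₂, t₁, M₁, m₁, hτ, hτre, hτrq, hττ, hP₂, hM₁, hm₁, ht₁, hrel₁, hYefix⟩ :=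
    exists_chiEAlpha_dataK_modFourAlpha ι hCST hGZ h12 h44 hS31 hnew hGZK hK hq hq4 hq7 hp4 hp7 hdK h2 D₀ hc hw h0 d hrq hrp
  set eL := Affine.Point.map (W' := cm7) (ringClassField K ι 1).subtype.toRatAlgHom with heL
  set TL : (cm7.baseChange (ringClassField K ι 1)).toAffine.Point :=
    Affine.Point.some 2 (-1) (nonsingular_cm7_baseChange_two_neg_one (ringClassField K ι 1)) with hTL
  set Pe : (cm7.baseChange (ringClassField K ι 1)).toAffine.Point :=
    ∑ σ : ringClassField K ι 1 ≃ₐ[K] ringClassField K ι 1, (if σ (rq * rp) = rq * rp then (1 : ℤ) else -1) •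
      Affine.Point.map (σ : ringClassField K ι 1 →ₐ[K] ringClassField K ι 1) d.y with hPe
  have hPe_eq : (∑ σ : ringClassField K ι 1 ≃ₐ[K] ringClassField K ι 1,
      ((if σ rq = rq then (1 : ℤ) else -1) * (if σ rp = rp then (1 : ℤ) else -1)) •
        Affine.Point.map (σ : ringClassField K ι 1 →ₐ[K] ringClassField K ι 1) d.y) = Pe :=
    Finset.sum_congr rfl fun σ _ ↦ by rw [chiSign_mul_eq hrK hrpK hrq0 hrp0 σ]
  rw [hPe_eq]
  have heLT : eL TL = Affine.Point.some 2 (-1) (nonsingular_cm7_baseChange_two_neg_one ℂ) := map_cm7_twoTorsion _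
  set ιF : (ℚ⟮rq * rp⟯ : IntermediateField ℚ (ringClassField K ι 1)) →+* ℂ :=
    (ringClassField K ι 1).subtype.comp (algebraMap (ℚ⟮rq * rp⟯ : IntermediateField ℚ (ringClassField K ι 1)) (ringClassField K ι 1)) with hιF
  have hP₂maps : eL (Affine.Point.map (ℚ⟮rq * rp⟯).val P₂) = Affine.Point.map (W' := cm7) ιF.toRatAlgHom P₂ := by
    rw [heL]; cases P₂ <;> rfl
  set Ye : (cm7.baseChange (ringClassField K ι 1)).toAffine.Point := Affine.Point.map (ℚ⟮rq * rp⟯).val P₂ with hYedef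
  have hF := isImaginaryQuadratic_adjoin_sqrt_neg_two_primes ι hq hp hre
  have hdF := discr_adjoin_sqrt_neg_two_primes ι hq hp hq4 hp4 hqp hre
  haveI := (finiteDimensional_and_isGalois_ringClassField hF ιF one_ne_zero).1
  haveI := (finiteDimensional_and_isGalois_ringClassField hF ιF one_ne_zero).2
  haveI : NumberField (ringClassField (ℚ⟮rq * rp⟯ : IntermediateField ℚ (ringClassField K ι 1)) ιF 1) := numberField_ringClassField hF ιF one_ne_zero
  have hreS : ((rq * rp : ringClassField K ι 1) : ℂ) ∈ S := by push_cast; exact S.mul_mem hSq hSp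
  have hFS : ∀ x : (ℚ⟮rq * rp⟯ : IntermediateField ℚ (ringClassField K ι 1)), ιF x ∈ S := fun x ↦
    algebraMap_adjoin_mem_of_mem (F₀ := ℚ) (ringClassField K ι 1).subtype S
      (fun y ↦ by rw [eq_ratCast, Subfield.coe_subtype, SubfieldClass.coe_ratCast]; exact SubfieldClass.ratCast_mem S y)
      (r := rq * rp) hreS x
  have hκ : ιF ⟨rq * rp, IntermediateField.mem_adjoin_simple_self ℚ (rq * rp)⟩ = (rq : ℂ) * (rp : ℂ) := by
    rw [hιF, RingHom.comp_apply, IntermediateField.algebraMap_apply, Subfield.coe_subtype]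
    rfl
  obtain ⟨κ', M', w, r', g, τ', Φ₁, Tr₁, P'₁, Y', t', hκ', hM', hw, hτ', hr'C, hg, hΦB, hP'B, hY'B, h2Φ₁, hTr₁, hrel', ht', -, hΦ₁fix,
    hY'fix, -, -, hτ'Φ, hτ'Y⟩ :=
    exists_partnerField_packageF_alpha_plusModFourAlpha ιF hEta₀ hD hEta h14 hCST hGZ h44 hBT hBF hnew hGZK hF hq h3 hq4 hq7 hp4 hp7 hα hpq hdF D₀ hc hw
      h0 H₂ P₂ hP₂ hrq hrp _ hκ B S hBS hSq hSp hFS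
  -- `ι_F` is made opaque from here on (its value would be unfolded by the unifier inside every `F[1]`-type)
  have hιFa : ∀ a : (ℚ⟮rq * rp⟯ : IntermediateField ℚ (ringClassField K ι 1)), ιF a = ((a : ringClassField K ι 1) : ℂ) := fun a ↦ rfl
  clear_value ιF
  set eF := Affine.Point.map (W' := cm7) (ringClassField (ℚ⟮rq * rp⟯ : IntermediateField ℚ (ringClassField K ι 1)) ιF 1).subtype.toRatAlgHom with heF
  have hTF : eF (Affine.Point.some 2 (-1) (nonsingular_cm7_baseChange_two_neg_one (ringClassField (ℚ⟮rq * rp⟯ : IntermediateField ℚ (ringClassField K ι 1)) ιF 1))) = Affine.Point.some 2 (-1) (nonsingular_cm7_baseChange_two_neg_one ℂ) := map_cm7_twoTorsion _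
  have hinj : Function.Injective eL := fun a b h ↦
    Affine.Point.map_injective (W' := cm7) (f := (ringClassField K ι 1).subtype.toRatAlgHom) h
  have hF₁inj : Function.Injective eF := fun a b h ↦ Affine.Point.map_injective (W' := cm7) (f := (ringClassField (ℚ⟮rq * rp⟯ : IntermediateField ℚ (ringClassField K ι 1)) ιF 1).subtype.toRatAlgHom) h
  -- `e_F Tr = e_L Y_e`
  have hTrYe : eF Tr₁ = eL Ye := by
    have hc' : (ringClassField (ℚ⟮rq * rp⟯ : IntermediateField ℚ (ringClassField K ι 1)) ιF 1).subtype.toRatAlgHom.comp (algebraMap (ℚ⟮rq * rp⟯ : IntermediateField ℚ (ringClassField K ι 1)) (ringClassField (ℚ⟮rq * rp⟯ : IntermediateField ℚ (ringClassField K ι 1)) ιF 1)).toRatAlgHom = ιF.toRatAlgHom :=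
      AlgHom.ext fun x ↦ coe_algebraMap_ringClassField ιF 1 x
    rw [hTr₁, heF, Affine.Point.map_map, hc', ← hP₂maps]
  -- (equalities of `ℂ`- and `F[1]`-points are closed by `simp only`: `rw [map_zsmul]` / a closing `rfl` there is too expensive)
  obtain ⟨ΦL, hΦL⟩ := hBL _ hΦB
  obtain ⟨P'L, hP'L⟩ := hBL _ hP'B
  obtain ⟨Y'L, hY'L⟩ := hBL _ hY'B
  have h2ΦL : (2 : ℤ) • ΦL = Ye + P'L := hinj (by
    have e := congrArg eF h2Φ₁
    simp only [map_zsmul, map_add] at e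
    simp only [map_zsmul, map_add, hΦL, hP'L, ← hTrYe, e])
  obtain ⟨t'L, ht'L⟩ : ∃ X : (cm7.baseChange (ringClassField K ι 1)).toAffine.Point, X = M' • P'L - (2 * w) • Y'L := ⟨_, rfl⟩
  have ht'eq : t' = M' • P'₁ - (2 * w) • Y' := eq_sub_of_add_eq' hrel'.symm
  have ht'LF : eL t'L = eF t' := by
    rw [ht'eq, ht'L]
    simp only [map_sub, map_zsmul, hP'L, hY'L]
  have ht'Lt : IsOfFinAddOrder t'L :=
    (Function.Injective.isOfFinAddOrder_iff hinj).mp (by rw [ht'LF]; exact eF.isOfFinAddOrder ht')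
  obtain ⟨Re, hRe⟩ : ∃ X : (cm7.baseChange (ringClassField K ι 1)).toAffine.Point, X = (m₁ * M') • ΦL - (m₁ * w) • Y'L := ⟨_, rfl⟩
  obtain ⟨te, hte⟩ : ∃ X : (cm7.baseChange (ringClassField K ι 1)).toAffine.Point, X = M' • t₁ - (2 * m₁) • t'L := ⟨_, rfl⟩
  have hrel : (M' * M₁) • Pe = (4 : ℤ) • Re + te := by
    rw [mul_zsmul, hrel₁, hRe, hte, ht'L]
    linear_combination (norm := module) (-(2 * m₁ * M')) • h2ΦL
  have hPeB : eL Pe ∈ B := hBfix Pe (fun σ h1 h2 ↦ (isChiPoint_twistedSum (K := K) hreK (mul_ne_zero hrq0 hrp0) d.y).1 σ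
    (by rw [map_mul, h1, h2]))
  have hYeB : eL Ye ∈ B := hBfix Ye (fun σ h1 h2 ↦ hYefix σ (by rw [map_mul, h1, h2]))
  have ht₁B : eL t₁ ∈ B := by
    rw [eq_sub_of_add_eq' hrel₁.symm, map_sub, map_zsmul, map_zsmul]
    exact B.sub_mem (B.zsmul_mem hPeB _) (B.zsmul_mem hYeB _)
  have hReB : eL Re ∈ B := by
    rw [hRe, map_sub, map_zsmul, map_zsmul, hΦL, hY'L]
    exact B.sub_mem (B.zsmul_mem hΦB _) (B.zsmul_mem hY'B _)
  have ht'B : eF t' ∈ B := by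
    rw [ht'eq]
    simp only [map_sub, map_zsmul]
    exact B.sub_mem (B.zsmul_mem hP'B _) (B.zsmul_mem hY'B _)
  have hteB : eL te ∈ B := by
    rw [hte, map_sub, map_zsmul, map_zsmul, ht'LF]
    exact B.sub_mem (B.zsmul_mem ht₁B _) (B.zsmul_mem ht'B _)
  have hte_t : IsOfFinAddOrder te := by
    obtain ⟨a, ha, ha0⟩ := (isOfFinAddOrder_iff_zsmul_eq_zero).mp ht₁
    obtain ⟨b, hb, hb0⟩ := (isOfFinAddOrder_iff_zsmul_eq_zero).mp ht'Lt
    refine (isOfFinAddOrder_iff_zsmul_eq_zero).mpr ⟨a * b, mul_ne_zero ha hb, ?_⟩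
    rw [hte, zsmul_sub, smul_smul, smul_smul, show a * b * M' = (b * M') * a by ring, show a * b * (2 * m₁) = (a * (2 * m₁)) * b by ring,
      mul_zsmul, ha0, zsmul_zero, mul_zsmul, hb0, zsmul_zero, sub_zero]
  refine ⟨M' * M₁, Re, te, hM'.mul hM₁, hte_t, hReB, hteB, hrel, fun σ hσq hσp ↦ ⟨1, odd_one, ?_⟩⟩
  -- the auxiliary `ψ = σ̃_qτ`: fixes `F = ℚ(r_qr_p)`, `r_q` AND `r_p` — its genus transport lies in the PRINCIPAL genus of `F`
  obtain ⟨ψ, hψ⟩ : ∃ ψ : ringClassField K ι 1 ≃ₐ[ℚ] ringClassField K ι 1, ψ = (σ.restrictScalars ℚ) * τ := ⟨_, rfl⟩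
  have hτx : ∀ x : ringClassField K ι 1, τ (τ x) = x := fun x ↦ by rw [← AlgEquiv.mul_apply, hττ, AlgEquiv.one_apply]
  have hψσ : ∀ X : (cm7.baseChange (ringClassField K ι 1)).toAffine.Point,
      Affine.Point.map (σ : ringClassField K ι 1 →ₐ[K] ringClassField K ι 1) X =
        Affine.Point.map (ψ : ringClassField K ι 1 →ₐ[ℚ] ringClassField K ι 1)
          (Affine.Point.map (τ : ringClassField K ι 1 →ₐ[ℚ] ringClassField K ι 1) X) := fun X ↦ by
    have e' : (σ : ringClassField K ι 1 →ₐ[K] ringClassField K ι 1).restrictScalars ℚ =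
        (ψ : ringClassField K ι 1 →ₐ[ℚ] ringClassField K ι 1).comp (τ : ringClassField K ι 1 →ₐ[ℚ] ringClassField K ι 1) :=
      AlgHom.ext fun x ↦ by
        change σ x = ψ (τ x)
        rw [hψ, AlgEquiv.mul_apply, AlgEquiv.restrictScalars_apply, hτx]
    rw [← map_restrictScalars_eq (K := K) σ, e', Affine.Point.map_map]
  have hψrq : ψ rq = rq := by
    rw [hψ, AlgEquiv.mul_apply, hτrq, map_neg, AlgEquiv.restrictScalars_apply, hσq, neg_neg]
  have hψre : ψ (rq * rp) = rq * rp := by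
    rw [hψ, AlgEquiv.mul_apply, hτre, map_neg, AlgEquiv.restrictScalars_apply, map_mul, hσq, hσp]; ring
  have hψrp : ψ rp = rp := by
    have h := hψre
    rw [map_mul, hψrq] at h
    exact mul_left_cancel₀ hrq0 h
  have hψF : ∀ a : (ℚ⟮rq * rp⟯ : IntermediateField ℚ (ringClassField K ι 1)), ψ (algebraMap _ (ringClassField K ι 1) a) = algebraMap _ (ringClassField K ι 1) a := fun a ↦ by
    rw [IntermediateField.algebraMap_apply]
    exact apply_eq_self_of_mem_adjoin_simple ψ hψre a.2
  have hcoe : ∀ a : (ℚ⟮rq * rp⟯ : IntermediateField ℚ (ringClassField K ι 1)), ((algebraMap _ (ringClassField (ℚ⟮rq * rp⟯ : IntermediateField ℚ (ringClassField K ι 1)) ιF 1) a : (ringClassField (ℚ⟮rq * rp⟯ : IntermediateField ℚ (ringClassField K ι 1)) ιF 1)) : ℂ) = ((algebraMap _ (ringClassField K ι 1) a : ringClassField K ι 1) : ℂ) :=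
    fun a ↦ by rw [coe_algebraMap_ringClassField, IntermediateField.algebraMap_apply]; exact hιFa a
  have hr : (rp : ℂ) = (r' : ℂ) := hr'C.symm
  -- `g̃²` fixes `r′`: a principal-genus representative realising `ψ` on the transported points
  have hgg : (g * g) r' = r' := by rw [AlgEquiv.mul_apply, hg, map_neg, hg, neg_neg]
  have hψg : ((ψ rp : ringClassField K ι 1) : ℂ) = (((g * g) r' : (ringClassField (ℚ⟮rq * rp⟯ : IntermediateField ℚ (ringClassField K ι 1)) ιF 1)) : ℂ) := by
    rw [hψrp, hgg, hr]
  have hTΦ : eL (Affine.Point.map (ψ : ringClassField K ι 1 →ₐ[ℚ] ringClassField K ι 1) ΦL) =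
      eF (Affine.Point.map ((g * g : (ringClassField (ℚ⟮rq * rp⟯ : IntermediateField ℚ (ringClassField K ι 1)) ιF 1) ≃ₐ[ℚ⟮rq * rp⟯] (ringClassField (ℚ⟮rq * rp⟯ : IntermediateField ℚ (ringClassField K ι 1)) ιF 1)) : (ringClassField (ℚ⟮rq * rp⟯ : IntermediateField ℚ (ringClassField K ι 1)) ιF 1) →ₐ[ℚ⟮rq * rp⟯] (ringClassField (ℚ⟮rq * rp⟯ : IntermediateField ℚ (ringClassField K ι 1)) ιF 1)) Φ₁) :=
    map_subtype_map_eq_of_genusTransport ι _ (ringClassField (ℚ⟮rq * rp⟯ : IntermediateField ℚ (ringClassField K ι 1)) ιF 1) hcoe r' rp hr ψ hψF (g * g) hψg Φ₁ hΦ₁fix ΦL hΦL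
  have hTY : eL (Affine.Point.map (ψ : ringClassField K ι 1 →ₐ[ℚ] ringClassField K ι 1) Y'L) =
      eF (Affine.Point.map ((g * g : (ringClassField (ℚ⟮rq * rp⟯ : IntermediateField ℚ (ringClassField K ι 1)) ιF 1) ≃ₐ[ℚ⟮rq * rp⟯] (ringClassField (ℚ⟮rq * rp⟯ : IntermediateField ℚ (ringClassField K ι 1)) ιF 1)) : (ringClassField (ℚ⟮rq * rp⟯ : IntermediateField ℚ (ringClassField K ι 1)) ιF 1) →ₐ[ℚ⟮rq * rp⟯] (ringClassField (ℚ⟮rq * rp⟯ : IntermediateField ℚ (ringClassField K ι 1)) ιF 1)) Y') :=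
    map_subtype_map_eq_of_genusTransport ι _ (ringClassField (ℚ⟮rq * rp⟯ : IntermediateField ℚ (ringClassField K ι 1)) ιF 1) hcoe r' rp hr ψ hψF (g * g) hψg Y' hY'fix Y'L hY'L
  have hcL : ∀ X, eL (Affine.Point.map (τ : ringClassField K ι 1 →ₐ[ℚ] ringClassField K ι 1) X) =
      Affine.Point.map (W' := cm7) conjRatAlgHom (eL X) := map_subtype_map_conj_cm7 τ hτ
  have hcF : ∀ X, eF (Affine.Point.map (τ' : (ringClassField (ℚ⟮rq * rp⟯ : IntermediateField ℚ (ringClassField K ι 1)) ιF 1) →ₐ[ℚ] (ringClassField (ℚ⟮rq * rp⟯ : IntermediateField ℚ (ringClassField K ι 1)) ιF 1)) X) = Affine.Point.map (W' := cm7) conjRatAlgHom (eF X) :=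
    map_subtype_map_conj_cm7 τ' hτ'
  have hψΦ : Affine.Point.map (ψ : ringClassField K ι 1 →ₐ[ℚ] ringClassField K ι 1) ΦL = ΦL := hinj (by rw [hTΦ, hΦ₁fix (g * g) hgg, hΦL])
  have hψY : Affine.Point.map (ψ : ringClassField K ι 1 →ₐ[ℚ] ringClassField K ι 1) Y'L = Y'L := hinj (by rw [hTY, hY'fix (g * g) hgg, hY'L])
  have hτΦ : Affine.Point.map (τ : ringClassField K ι 1 →ₐ[ℚ] ringClassField K ι 1) ΦL = (κ' : ℤ) • TL - ΦL := hinj (by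
    rw [hcL, hΦL, ← hcF, hτ'Φ]; simp only [map_sub, map_zsmul, hTF, hΦL, heLT])
  have hτY : Affine.Point.map (τ : ringClassField K ι 1 →ₐ[ℚ] ringClassField K ι 1) Y'L = TL - Y'L := hinj (by
    rw [hcL, hY'L, ← hcF, hτ'Y]; simp only [map_sub, hTF, hY'L, heLT])
  have hψT : Affine.Point.map (ψ : ringClassField K ι 1 →ₐ[ℚ] ringClassField K ι 1) TL = TL := by
    rw [hTL, Affine.Point.map_some]; congr 1
    · exact map_ofNat _ 2
    · simp only [map_neg, map_one]
  have hT2 : 2 • TL = 0 := by rw [two_nsmul]; exact cm7_twoTorsion_add_self _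
  have e1 : Affine.Point.map (τ : ringClassField K ι 1 →ₐ[ℚ] ringClassField K ι 1) Re =
      (m₁ * M') • ((κ' : ℤ) • TL - ΦL) - (m₁ * w) • (TL - Y'L) := by rw [hRe, map_sub, map_zsmul, map_zsmul, hτΦ, hτY]
  have e2 : Affine.Point.map (σ : ringClassField K ι 1 →ₐ[K] ringClassField K ι 1) Re =
      (m₁ * M') • ((κ' : ℤ) • TL - ΦL) - (m₁ * w) • (TL - Y'L) := by
    rw [hψσ, e1, map_sub, map_zsmul, map_zsmul, map_sub, map_sub, map_zsmul, hψT, hψΦ, hψY]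
  -- `σ̃_qR_e + R_e = (m₁M′κ′ − m₁w) • T`, an ODD multiple of `T` since `κ′` is even and `m₁, M′, w` are odd
  have hfinal : Affine.Point.map (σ : ringClassField K ι 1 →ₐ[K] ringClassField K ι 1) Re + Re = (m₁ * M' * (κ' : ℤ) - m₁ * w) • TL := by
    rw [e2, hRe]
    module
  rw [one_zsmul, hfinal]
  exact zsmul_twoTorsion_of_odd hT2 ((((Int.even_coe_nat κ').mpr hκ').mul_left (m₁ * M')).sub_odd (hm₁.mul hw))

end ChiE

end Summit.BirchSwinnertonDyer.BirchSwinnertonDyer.Theorems.GoldfeldGoodTwists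

end
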